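import Literature.MathematicalPhysics.QuantumFieldTheory.Balaban1983to89.B7Prop3GeneralLinear
import Literature.MathematicalPhysics.QuantumFieldTheory.Balaban1983to89.B7Prop3GeneralAnalytic

/-!
# `Balaban1983to89.B7Eq122LinearPartIsLinear` — T. Bałaban, *Averaging operations for lattice gauge theories*, Commun. Math. Phys. **98**
# (1985) 17–51 [Balaban1985Averaging], Proposition 3 (121)–(124) p. 36, with [Balaban1985BackgroundPropagators] (3.13)–(3.15) p. 393:
# THE LINEAR PART `L(Q(V₀)A)_c = L·(Q(V₀)A)_c` OF `Q(V₀, A, c) = (1/i) log V̿₁(c)` IS A LINEAR MAP OF `A` — `L` (the block size) times the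
# one-step averaging operator `Q(V₀)` of [B9] (3.15) («`Q_j(U)A` is a linear part of the function (3.13) … compositions of `j` one-step averaging
# operators … where `Q(V)` is given by the explicit formula (124) in [5]») AS A LINEAR MAP at a regular background, from the analyticity half of Prop. 3
# (v1.1: DOCFIX — declarations byte-identical to v1 p292919; the (3.13)–(3.14) quotation corrected and the `L`-normalisation made explicit)

statement-level skeleton of published theorems with citation tags; proofs where landed; nothing here is a claim
about the Yang–Mills mass gap

PDF held: `paper:balaban1985-cmp98-averaging` (journal page = PDF page + 16), `paper:balaban1985-cmp99-background-propagators` (journal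
page = PDF page + 388); p. 36 / p. 393 read by this seat (2026-08-21) in the held texts (the verbatim quotations of (120)–(126) are in the
header of `B7Prop3GeneralLinear`, read there from the renders).

THE PRINT (verbatim).  [B7] p. 36: *«Let us define Q(V₀, A, c) = (1/i) log(V̿₁)_c, (121) then Q(V₀, A, c) is an analytic function of A and
from (120) it follows that its Taylor expansion begins with a first-order polynomial. Let us denote it by L(Q(V₀)A)_c. Thus we have
Q(V₀, A, c) = L(Q(V₀)A)_c + C(V₀, A, c). (122) C(V₀, A, c) is an analytic function of A whose Taylor's expansion begins with a
second-order polynomial (a quadratic form) … The linear form Q(V₀)A is given by (124)»*; p. 37 (render `…/1985-cmp98-averaging-p021-x2.png`): *«|Q(U₀, ηA) − LηQ(U₀)A| ≦ C₁(L|ηA|)² < C₁(α₁Lη)²»*.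
[B9] pp. 392–393 (renders `…/1985-cmp99-background-propagators-p004-x2.png`, `…-p005-x2.png` read as images by this seat, 2026-08-21): *«We replace
U₀ by U in these definitions, and we have for the function Q_j(U, ηA) = (1/i) log \overline{\overline{(exp iηA)}}{}^j (3.13) the following expansion
(1/(L^jη)) Q_j(U, ηA) = Q_j(U)A + (1/(L^jη)) C_j(U, L^jηA), (3.14) where Q_j(U)A is a linear part of the function (3.13) and C_j(U, A) is an
analytic function of A whose expansion begins with second order terms. We are interested in the linear operators Q_j(U). They are compositions of j one-step averaging operators
Q_j(U) = Q(Ū^{j−1})…Q(Ū)Q(U), (3.15) where Q(V) is given by the explicit formula (124) in [5]. These definitions extend straightforwardly to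
configurations U, A with values in the complexified group Gᶜ and algebra 𝔤ᶜ, see Sect. E in [5].»*

WHY THIS FILE (cell context).  The averaging operator `Q = Q_k(U₀)` is the central DATA letter of the pub-balaban NE9 letter chain
(`H₁ = G₁Q*(QG₁Q*)⁻¹`, `G₁ = (Δ₁ + DRD* + aQ*Q)⁻¹`: `B11Eq110GreenInverse`, `B11Eq103H1Complex`).  The tree holds its one-step factor
at a general background as the OBJECT `B7Prop3GeneralLinear.linQcov L V₀ A q κ` = «L(Q(V₀)A)_c» := the derivative at `0` of
`t ↦ Q(V₀, tA, c)` — with its LINEARITY IN `A` recorded there as *«NOT CERTIFIED (iv) … (it follows from (i)–(ii), or from (iii))»*.  This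
file certifies (iv) from (iii): `B7Prop3GeneralAnalytic.prop3_general_analyticAt` gives the analyticity of `Q(V₀, ·, c)` at `A = 0` along
every analytic finite-dimensional family (no smallness needed AT `0`), so the first-order Taylor term is the Fréchet derivative applied to
`A` — additive and homogeneous (chain rule through the two-parameter family `(s, t) ↦ sA₁ + tA₂` and the ray `t ↦ t(cA)`).  Hence
**`L·Q(V₀)` — hence `Q(V₀)` — IS A LINEAR MAP** of the `𝔤ᶜ`-valued configurations (`linQAt`, and `linQOp` on all coarse bonds): `L` times the
factor of (3.15).  NORMALISATION (READING C-adv4-22 of (122), as in `B7Prop3GeneralLinear`/`B7Prop3Flat.linQ_eq_smul_Q0form`; [B7] p. 37 «LηQ(U₀)A»,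
[B9] (3.14) «(1/(L^jη)) Q_j(U, ηA) = Q_j(U)A + …»): «L(Q(V₀)A)_c» = `linQcov` is `L·(Q(V₀)A)_c` with `L` THE BLOCK SIZE, so this file's `linQAt`/`linQOp`
are `L·Q(V₀)` and `QjOp j` is the UN-NORMALISED composite `L^j·Q_j(U)` = the linear part of (3.13) itself; print's `Q(V₀)` / `Q_j(U)` are `L⁻¹ •` /
`(L^j)⁻¹ •` these (material to the consumers (3.16) `Σ_j a Σ_b (L^jη)^{d−2}|(Q_j(U)A)(b)|²` and `G₁ = (Δ₁ + DRD* + aQ*Q)⁻¹`, immaterial to linearity).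

WHAT IS PROVED (sorry-free; no `Prop` placeholder; [B7] Prop. 3 is NOT asserted — only its analyticity-at-`0` consequence, which the tree
proves, is used).
* §1 `analyticAt_Qcov_family` — `t ↦ Q(V₀, B(t), c)` is analytic at `t₀` for an analytic family `B` with `B(t₀) = 0`, at a background `V₀ ∈ U1`
  whose block contours are `α`-regular at `c` (`α ≤ 1/64`): `prop3_general_analyticAt` at `a = θ = 0`.
* §2 **`linQcov_add`**, **`linQcov_smul`**, `linQcov_zero'` — «L(Q(V₀)A)_c» is additive and homogeneous in `A`.
* §3 **`linQAt`** : `(Site d → Fin d → 𝔸) →ₗ[ℂ] 𝔸` — `A ↦ L·(Q(V₀)A)_c` = «L(Q(V₀)A)_c» at the coarse bond `c = (q, κ)` AS A LINEAR MAP (print's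
  `(Q(V₀)A)_c` = `L⁻¹ •` this), `linQAt_apply` (= `linQcov`, by `rfl`); **`linQOp`** : `(Site d → Fin d → 𝔸) →ₗ[ℂ] (Site d → Fin d → 𝔸)` — `L·Q(V₀)` on all coarse bonds (under
  regularity at every `c`), `linQOp_apply`; `linQAt_one_eq_linQ` ∕ `linQAt_one_eq_linQ'` (flat background = lit-balaban's `B7Prop3Flat.linQ`; in the primed form the
  `U1`∕regularity letters are DISCHARGED by `one_mem_U1` ∕ `flat_regular` — `B8Ineq130.Wcx_one`).
* §4 `rescaleLin` (the b07 `rescale` — `Ω^{(j+1)} ≅ ℤ^d` — as a linear map) and **`QjOp … j`** : `(Site d → Fin d → 𝔸) →ₗ[ℂ] (Site d → Fin d → 𝔸)`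
  — **the UN-NORMALISED composite `L^j·Q_j(U) = (L·Q(Ū^{j−1}))…(L·Q(Ū))(L·Q(U))` of [B9] (3.15) AS AN OBJECT** (the linear part of (3.13); print's
  `Q_j(U)` = `(L^j)⁻¹ •` this): the composition of the one-step linear maps at the successively averaged
  backgrounds `Ū^i = B7Prop2Explicit.avgIter L U i` ((43)), each level read on the unit lattice exactly as in the tree's nonlinear recursion
  `B7Eq92Concrete.dbavgCovIter` ((90)–(91)); displayed hypotheses: every `Ū^i` unit-bounded with `α`-regular block contours ([B7] (52)–(53),
  Prop. 2 — NOT proved here); `QjOp_zero`, `QjOp_succ`, `QjOp_succ_apply`, `QjOp_one_apply`.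
MODEL / DECLARED READINGS.  (M1) the b07 lineage's setting: sites `ℤ^d` (`B7Prop1Explicit.Site`), `L`-blocks, configurations with values in
the units of a complete normed `ℂ`-algebra `𝔸` with `‖1‖ = 1`, the Lie-algebra variable written `A` for print's `iA`; coarse bonds
`c = ⟨q, q + Le_κ⟩ ↦ (q, κ)`.  (M2) the composition (3.15) over scales and the torus carriers of the NE9 chain (`B9SectCLatticeCarrier`) are NOT
addressed here (next bricks); (124)'s explicit five-term formula and the bound (126) remain `B7Prop3GeneralLinear`'s open items (i)–(ii);
the identification of `QjOp j` with the linear part of (3.13) `(1/i) log \overline{\overline{(exp iA)}}{}^j` ((3.14) — the chain rule along the analytic curve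
`t ↦ (1/i) log 𝔘̿^i(e^{tA})` through `dbavgCovIter`) is NOT certified here: (3.15) is taken as print states it («They are compositions …»).
HONEST SCOPE.  One elementary consequence (linearity of a first-order Taylor term) of an analyticity statement the tree already proves; no
estimate of the paper; NOT summit progress (cell pub-balaban: NE9 NOT PRINTED / NOT PROVED; spine PROVED 0/9).  Filed by the pub-balaban NE9
BINDER-row owner lineage `b2b-balaban-t4-ne9-p1` (gen 77); a NEW file importing `B7Prop3GeneralLinear` and `B7Prop3GeneralAnalytic`; nothing of
the b07 / NE7c lineages' files is modified.  Net new unproved facts: 0.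
-/

noncomputable section

open scoped BigOperators

namespace Literature.MathematicalPhysics.QuantumFieldTheory.Balaban1983to89.B7Eq122LinearPartIsLinear

open B7Prop1Explicit B7Prop3Flat B7Eq92Concrete MatrixLog
open B7Prop2Explicit (rescale rescale_apply avgIter avgIter_zero)
open B7Prop3GeneralLinear (Qcov linQcov linQcov_one_left)
open B7Prop3GeneralAnalytic (prop3_general_analyticAt)

-- `Site` alone would resolve to the torus sites of `Setup.lean`; re-export the `ℤ^d` sites of `B7Prop1Explicit`.
export B7Prop1Explicit (Site)

variable {d : ℕ} {𝔸 : Type*} [NormedRing 𝔸] [NormedAlgebra ℂ 𝔸] [CompleteSpace 𝔸] [NormOneClass 𝔸]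

section Regular

variable {L : ℕ} (hL : 1 ≤ L) {V₀ : Site d → Fin d → 𝔸ˣ} (hV₀ : ∀ x κ, V₀ x κ ∈ U1 𝔸) (q : Site d) (κ : Fin d) {α : ℝ} (hα1 : α ≤ 1 / 64)
  (hreg : ∀ r : Fin d → Fin L, ‖((Wcx L V₀ q κ (boxVec L r) : 𝔸ˣ) : 𝔸) - 1‖ ≤ α)

/-! ## §1 `Q(V₀, ·, c)` is analytic at `A = 0` along analytic families -/

include hL hV₀ hα1 hreg in
/-- **«Q(V₀, A, c) is an analytic function of A» AT `A = 0`, along any analytic finite-dimensional family `B(t)` with `B(t₀) = 0`** — the tree's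
`prop3_general_analyticAt` with the field bound `a = 0` and `θ = 0` (at `A = 0` no smallness of `A` is needed; the background must be unit-
bounded with `α`-regular block contours at `c`). [cite: Balaban1985Averaging, Proposition 3 (121) p.36] -/
theorem analyticAt_Qcov_family {E : Type*} [NormedAddCommGroup E] [NormedSpace ℂ E] (B : E → Site d → Fin d → 𝔸) {t₀ : E}
    (hB : ∀ x κ', AnalyticAt ℂ (fun t => B t x κ') t₀) (hB0 : B t₀ = 0) :
    AnalyticAt ℂ (fun t => Qcov L V₀ (B t) q κ) t₀ := by
  have hA : ∀ x κ', ‖B t₀ x κ'‖ ≤ 0 := fun x κ' => by rw [hB0]; simp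
  have hθ : ((2 * (d * L) + L + L : ℕ) : ℝ) * 0 ≤ 0 := by rw [mul_zero]
  exact prop3_general_analyticAt B hB hL hV₀ le_rfl hA hθ le_rfl (by norm_num) q κ hα1 hreg

/-! ## §2 «L(Q(V₀)A)_c» is additive and homogeneous in `A` -/

omit [CompleteSpace 𝔸] [NormOneClass 𝔸] in
/-- The two-parameter family `(s, t) ↦ sA₁ + tA₂` is analytic, componentwise. [cite: Balaban1985Averaging, (122) p.36] -/
theorem analyticAt_twoParam (A₁ A₂ : Site d → Fin d → 𝔸) (x : Site d) (κ' : Fin d) (p₀ : ℂ × ℂ) :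
    AnalyticAt ℂ (fun p : ℂ × ℂ => (p.1 • A₁ + p.2 • A₂) x κ') p₀ := by
  have h1 : AnalyticAt ℂ (fun p : ℂ × ℂ => p.1) p₀ := (ContinuousLinearMap.fst ℂ ℂ ℂ).analyticAt p₀
  have h2 : AnalyticAt ℂ (fun p : ℂ × ℂ => p.2) p₀ := (ContinuousLinearMap.snd ℂ ℂ ℂ).analyticAt p₀
  simpa only [Pi.add_apply, Pi.smul_apply] using (h1.fun_smul analyticAt_const).fun_add (h2.fun_smul analyticAt_const)

include hL hV₀ hα1 hreg in
/-- **ADDITIVITY: `L(Q(V₀)(A₁ + A₂))_c = L(Q(V₀)A₁)_c + L(Q(V₀)A₂)_c`** — the first-order Taylor term of the analytic `Q(V₀, ·, c)` at `0` is the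
Fréchet derivative of the two-parameter restriction, evaluated at `(1,1) = (1,0) + (0,1)`. [cite: Balaban1985Averaging, (122) p.36, (124) p.36] -/
theorem linQcov_add (A₁ A₂ : Site d → Fin d → 𝔸) :
    linQcov L V₀ (A₁ + A₂) q κ = linQcov L V₀ A₁ q κ + linQcov L V₀ A₂ q κ := by
  set G : ℂ × ℂ → 𝔸 := fun p => Qcov L V₀ (p.1 • A₁ + p.2 • A₂) q κ with hG
  have hGa : AnalyticAt ℂ G 0 :=
    analyticAt_Qcov_family hL hV₀ q κ hα1 hreg (fun p : ℂ × ℂ => p.1 • A₁ + p.2 • A₂) (t₀ := 0)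
      (fun x κ' => analyticAt_twoParam A₁ A₂ x κ' 0) (by simp)
  have hGd : HasFDerivAt G (fderiv ℂ G 0) 0 := hGa.differentiableAt.hasFDerivAt
  -- restriction along a linear map `φ : ℂ →L[ℂ] ℂ × ℂ`
  have key : ∀ φ : ℂ →L[ℂ] ℂ × ℂ, HasDerivAt (fun t : ℂ => G (φ t)) (fderiv ℂ G 0 (φ 1)) 0 := by
    intro φ
    have hG0 : HasFDerivAt G (fderiv ℂ G 0) (φ 0) := by rw [map_zero]; exact hGd
    have hc := hG0.comp (0 : ℂ) φ.hasFDerivAt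
    simpa only [ContinuousLinearMap.comp_apply, Function.comp_def] using hc.hasDerivAt
  have h1 : linQcov L V₀ A₁ q κ = fderiv ℂ G 0 (1, 0) := by
    have h := key (ContinuousLinearMap.inl ℂ ℂ ℂ)
    have hfun : (fun t : ℂ => G (ContinuousLinearMap.inl ℂ ℂ ℂ t)) = fun t : ℂ => Qcov L V₀ (t • A₁) q κ := by
      funext t; simp [hG]
    rw [hfun, ContinuousLinearMap.inl_apply] at h
    exact h.deriv
  have h2 : linQcov L V₀ A₂ q κ = fderiv ℂ G 0 (0, 1) := by
    have h := key (ContinuousLinearMap.inr ℂ ℂ ℂ)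
    have hfun : (fun t : ℂ => G (ContinuousLinearMap.inr ℂ ℂ ℂ t)) = fun t : ℂ => Qcov L V₀ (t • A₂) q κ := by
      funext t; simp [hG]
    rw [hfun, ContinuousLinearMap.inr_apply] at h
    exact h.deriv
  have h12 : linQcov L V₀ (A₁ + A₂) q κ = fderiv ℂ G 0 (1, 1) := by
    have h := key (ContinuousLinearMap.inl ℂ ℂ ℂ + ContinuousLinearMap.inr ℂ ℂ ℂ)
    have hfun : (fun t : ℂ => G ((ContinuousLinearMap.inl ℂ ℂ ℂ + ContinuousLinearMap.inr ℂ ℂ ℂ) t)) =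
        fun t : ℂ => Qcov L V₀ (t • (A₁ + A₂)) q κ := by
      funext t; simp [hG, smul_add]
    have hpt : (ContinuousLinearMap.inl ℂ ℂ ℂ + ContinuousLinearMap.inr ℂ ℂ ℂ) (1 : ℂ) = ((1 : ℂ), (1 : ℂ)) := by
      simp
    rw [hfun, hpt] at h
    exact h.deriv
  rw [h1, h2, h12, show ((1 : ℂ), (1 : ℂ)) = ((1 : ℂ), (0 : ℂ)) + ((0 : ℂ), (1 : ℂ)) by simp, map_add]

include hL hV₀ hα1 hreg in
/-- **HOMOGENEITY: `L(Q(V₀)(cA))_c = c·L(Q(V₀)A)_c`** — chain rule along the ray `t ↦ t(cA) = (tc)A`. [cite: Balaban1985Averaging, (122) p.36, (124) p.36] -/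
theorem linQcov_smul (c : ℂ) (A : Site d → Fin d → 𝔸) : linQcov L V₀ (c • A) q κ = c • linQcov L V₀ A q κ := by
  have hga : AnalyticAt ℂ (fun t : ℂ => Qcov L V₀ (t • A) q κ) 0 :=
    analyticAt_Qcov_family hL hV₀ q κ hα1 hreg (fun t : ℂ => t • A) (t₀ := 0)
      (fun x κ' => by simpa only [Pi.smul_apply, id_eq] using (analyticAt_id.fun_smul analyticAt_const)) (by simp)
  have hgd : HasDerivAt (fun t : ℂ => Qcov L V₀ (t • A) q κ) (linQcov L V₀ A q κ) 0 := by
    unfold linQcov; exact hga.differentiableAt.hasDerivAt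
  have hu : HasDerivAt (fun t : ℂ => t * c) c 0 := by simpa using (hasDerivAt_id (0 : ℂ)).mul_const c
  have hgd' : HasDerivAt (fun t : ℂ => Qcov L V₀ (t • A) q κ) (linQcov L V₀ A q κ) ((fun t : ℂ => t * c) 0) := by
    simp only [zero_mul]; exact hgd
  have hcomp := HasDerivAt.scomp (0 : ℂ) hgd' hu
  have heq : (fun t : ℂ => Qcov L V₀ (t • (c • A)) q κ) = (fun t : ℂ => Qcov L V₀ (t • A) q κ) ∘ fun t : ℂ => t * c := by
    funext t; simp only [Function.comp_apply, smul_smul]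
  change deriv (fun t : ℂ => Qcov L V₀ (t • (c • A)) q κ) 0 = c • linQcov L V₀ A q κ
  rw [heq, hcomp.deriv]

include hL hV₀ hα1 hreg in
/-- `L(Q(V₀)0)_c = 0`. [cite: Balaban1985Averaging, (122) p.36] -/
theorem linQcov_zero' : linQcov L V₀ (0 : Site d → Fin d → 𝔸) q κ = 0 := by
  have h := linQcov_smul hL hV₀ q κ hα1 hreg 0 (0 : Site d → Fin d → 𝔸)
  rwa [zero_smul, zero_smul] at h

/-! ## §3 The one-step averaging operator `Q(V₀)` of [B9] (3.15) AS A LINEAR MAP -/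

/-- **`A ↦ L·(Q(V₀)A)_c` = «L(Q(V₀)A)_c» AS A LINEAR MAP** at the coarse bond `c = (q, κ)` — `L` (the block size) times «the linear form Q(V₀)A» of
[B7] (122)/(124), the one-step factor `Q(V)` of [B9] (3.15) (print's `(Q(V₀)A)_c` = `L⁻¹ •` this map; cf. `B7Prop3Flat.linQ_eq_smul_Q0form`), for a
background `V₀ ∈ U1` with `α`-regular block contours at `c`; its value is `B7Prop3GeneralLinear.linQcov` (by `rfl`).
[cite: Balaban1985Averaging, (124) p.36; Balaban1985BackgroundPropagators, (3.15) p.393] -/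
def linQAt (_hL : 1 ≤ L) (_hV₀ : ∀ x κ, V₀ x κ ∈ U1 𝔸) (q : Site d) (κ : Fin d) (_hα1 : α ≤ 1 / 64)
    (_hreg : ∀ r : Fin d → Fin L, ‖((Wcx L V₀ q κ (boxVec L r) : 𝔸ˣ) : 𝔸) - 1‖ ≤ α) : (Site d → Fin d → 𝔸) →ₗ[ℂ] 𝔸 where
  toFun A := linQcov L V₀ A q κ
  map_add' A₁ A₂ := linQcov_add _hL _hV₀ q κ _hα1 _hreg A₁ A₂
  map_smul' c A := linQcov_smul _hL _hV₀ q κ _hα1 _hreg c A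

/-- `linQAt … A = linQcov L V₀ A q κ` = «L(Q(V₀)A)_c». [cite: Balaban1985Averaging, (122) p.36] -/
@[simp] theorem linQAt_apply (A : Site d → Fin d → 𝔸) : linQAt hL hV₀ q κ hα1 hreg A = linQcov L V₀ A q κ := rfl

/-- At the flat background (`V₀ = 1`, automatically regular) the linear map is lit-balaban's flat linear part `B7Prop3Flat.linQ` (for bounded `A`).
[cite: Balaban1985Averaging, (124)–(125) p.36] -/
theorem linQAt_one_eq_linQ (hV₁ : ∀ x κ, (1 : Site d → Fin d → 𝔸ˣ) x κ ∈ U1 𝔸)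
    (hreg₁ : ∀ r : Fin d → Fin L, ‖((Wcx L (1 : Site d → Fin d → 𝔸ˣ) q κ (boxVec L r) : 𝔸ˣ) : 𝔸) - 1‖ ≤ α)
    (A : Site d → Fin d → 𝔸) {M : ℝ} (hM0 : 0 ≤ M) (hM : ∀ x κ, ‖A x κ‖ ≤ M) :
    linQAt hL hV₁ q κ hα1 hreg₁ A = linQ L A q κ := by
  rw [linQAt_apply, linQcov_one_left L hL A hM0 hM q κ]

omit [NormedAlgebra ℂ 𝔸] [CompleteSpace 𝔸] in
/-- The flat background is unit-bounded. [cite: Balaban1985Averaging, (124)–(125) p.36] -/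
theorem one_mem_U1 (x : Site d) (κ' : Fin d) : (1 : Site d → Fin d → 𝔸ˣ) x κ' ∈ U1 𝔸 := Subgroup.one_mem _

omit [NormedAlgebra ℂ 𝔸] [CompleteSpace 𝔸] [NormOneClass 𝔸] in
/-- The flat background has `0`-regular block contours (`W_{c,x} = 1`, `B8Ineq130.Wcx_one`). [cite: Balaban1985Averaging, (124)–(125) p.36] -/
theorem flat_regular (r : Fin d → Fin L) : ‖((Wcx L (1 : Site d → Fin d → 𝔸ˣ) q κ (boxVec L r) : 𝔸ˣ) : 𝔸) - 1‖ ≤ 0 := by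
  rw [B8Ineq130.Wcx_one, Units.val_one, sub_self, norm_zero]

/-- **At the flat background the linear map IS lit-balaban's `linQ`, with the regularity letters DISCHARGED** (`U1`, `α = 0`).
[cite: Balaban1985Averaging, (124)–(125) p.36] -/
theorem linQAt_one_eq_linQ' (A : Site d → Fin d → 𝔸) {M : ℝ} (hM0 : 0 ≤ M) (hM : ∀ x κ, ‖A x κ‖ ≤ M) :
    linQAt hL (fun x κ' => one_mem_U1 x κ') q κ (show (0 : ℝ) ≤ 1 / 64 by norm_num) (flat_regular q κ) A = linQ L A q κ :=
  linQAt_one_eq_linQ hL q κ _ _ _ A hM0 hM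

end Regular

/-! ### `Q(V₀)` on all coarse bonds -/

section Operator

variable {L : ℕ} (hL : 1 ≤ L) {V₀ : Site d → Fin d → 𝔸ˣ} (hV₀ : ∀ x κ, V₀ x κ ∈ U1 𝔸) {α : ℝ} (hα1 : α ≤ 1 / 64)
  (hreg : ∀ (q : Site d) (κ : Fin d) (r : Fin d → Fin L), ‖((Wcx L V₀ q κ (boxVec L r) : 𝔸ˣ) : 𝔸) - 1‖ ≤ α)

/-- **`L` TIMES THE ONE-STEP AVERAGING OPERATOR `Q(V₀)`, AS A LINEAR MAP of the configurations** — «L(Q(V₀)A)_c» = `L·(Q(V₀)A)_c` at every coarse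
bond `c = (q, κ)` (the coarse lattice `LZ^d` indexed by its base sites `q ∈ ℤ^d`, as in the b07 lineage), for a unit-bounded background whose block
contours are `α`-regular everywhere (`α ≤ 1/64`): `L` times the factor `Q(V)` of [B9] (3.15) `Q_j(U) = Q(Ū^{j−1})…Q(Ū)Q(U)` (print's `Q(V₀)` = `L⁻¹ •` this).
[cite: Balaban1985BackgroundPropagators, (3.15) p.393; Balaban1985Averaging, (124) p.36] -/
def linQOp (_hL : 1 ≤ L) (_hV₀ : ∀ x κ, V₀ x κ ∈ U1 𝔸) (_hα1 : α ≤ 1 / 64)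
    (_hreg : ∀ (q : Site d) (κ : Fin d) (r : Fin d → Fin L), ‖((Wcx L V₀ q κ (boxVec L r) : 𝔸ˣ) : 𝔸) - 1‖ ≤ α) :
    (Site d → Fin d → 𝔸) →ₗ[ℂ] (Site d → Fin d → 𝔸) :=
  LinearMap.pi fun q => LinearMap.pi fun κ => linQAt _hL _hV₀ q κ _hα1 (_hreg q κ)

/-- `(Q(V₀)A)(q, κ) = L(Q(V₀)A)_{(q,κ)}`. [cite: Balaban1985Averaging, (122) p.36] -/
@[simp] theorem linQOp_apply (A : Site d → Fin d → 𝔸) (q : Site d) (κ : Fin d) : linQOp hL hV₀ hα1 hreg A q κ = linQcov L V₀ A q κ := rfl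

end Operator


/-! ## §4 [B9] (3.15): `Q_j(U) = Q(Ū^{j−1})…Q(Ū)Q(U)` as a composition of linear maps over the averaged backgrounds -/

section Composite

/-- **Rescaling as a LINEAR map** of the `𝔤ᶜ`-valued configurations. [cite: Balaban1985Averaging, (1) p.17, p.19] -/
def rescaleLin (L : ℕ) : (Site d → Fin d → 𝔸) →ₗ[ℂ] (Site d → Fin d → 𝔸) where
  toFun := rescale L
  map_add' _ _ := rfl
  map_smul' _ _ := rfl

omit [CompleteSpace 𝔸] [NormOneClass 𝔸] in
/-- `rescaleLin L A z κ = A (Lz) κ`. [cite: Balaban1985Averaging, (1) p.17] -/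
@[simp] theorem rescaleLin_apply (L : ℕ) (A : Site d → Fin d → 𝔸) (z : Site d) (κ : Fin d) :
    rescaleLin L A z κ = A ((L : ℤ) • z) κ := rfl

variable {L : ℕ} {U : Site d → Fin d → 𝔸ˣ} {α : ℝ}

/-- **THE UN-NORMALISED COMPOSITE `L^j·Q_j(U) = (L·Q(Ū^{j−1}))·…·(L·Q(Ū))(L·Q(U))` of [B9] (3.15) AS A LINEAR MAP** (= the linear part of (3.13)
`(1/i) log \overline{\overline{(exp iηA)}}{}^j` itself; print's `Q_j(U)` of (3.14) = `(L^j)⁻¹ •` this) — «compositions of j one-step averaging operators»,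
the `i`-th factor being `L` times the one-step map, `linQOp`, at the `i`-fold averaged background `Ū^i = avgIter L U i` ([B7] (43)), each level read on the unit lattice
(`rescaleLin`) exactly as in the nonlinear recursion (90)–(91) `B7Eq92Concrete.dbavgCovIter`; the displayed hypotheses are the unit-boundedness
and the `α`-regularity of the block contours of EVERY averaged background ([B7] (52)–(53) / Proposition 2 — not proved here).
[cite: Balaban1985BackgroundPropagators, (3.15) p.393; Balaban1985Averaging, (90)–(91) p.31] -/
def QjOp (hL : 1 ≤ L) (hα1 : α ≤ 1 / 64) (hU1 : ∀ (i : ℕ) (x : Site d) (κ : Fin d), avgIter L U i x κ ∈ U1 𝔸)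
    (hreg : ∀ (i : ℕ) (q : Site d) (κ : Fin d) (r : Fin d → Fin L), ‖((Wcx L (avgIter L U i) q κ (boxVec L r) : 𝔸ˣ) : 𝔸) - 1‖ ≤ α) :
    ℕ → ((Site d → Fin d → 𝔸) →ₗ[ℂ] (Site d → Fin d → 𝔸))
  | 0 => LinearMap.id
  | j + 1 => rescaleLin L ∘ₗ linQOp hL (hU1 j) hα1 (hreg j) ∘ₗ QjOp hL hα1 hU1 hreg j

variable (hL : 1 ≤ L) (hα1 : α ≤ 1 / 64) (hU1 : ∀ (i : ℕ) (x : Site d) (κ : Fin d), avgIter L U i x κ ∈ U1 𝔸)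
  (hreg : ∀ (i : ℕ) (q : Site d) (κ : Fin d) (r : Fin d → Fin L), ‖((Wcx L (avgIter L U i) q κ (boxVec L r) : 𝔸ˣ) : 𝔸) - 1‖ ≤ α)

/-- `Q_0(U) = 1`. [cite: Balaban1985BackgroundPropagators, (3.15) p.393] -/
@[simp] theorem QjOp_zero : QjOp hL hα1 hU1 hreg 0 = LinearMap.id := rfl

/-- **`L^{j+1}·Q_{j+1}(U) = (L·Q(Ū^j)) ∘ (L^j·Q_j(U))`** (read on the unit lattice). [cite: Balaban1985BackgroundPropagators, (3.15) p.393] -/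
theorem QjOp_succ (j : ℕ) : QjOp hL hα1 hU1 hreg (j + 1) = rescaleLin L ∘ₗ linQOp hL (hU1 j) hα1 (hreg j) ∘ₗ QjOp hL hα1 hU1 hreg j := rfl

/-- Bondwise: `(L^{j+1}·Q_{j+1}(U)A)(z, κ) = L(Q(Ū^j)(L^j·Q_j(U)A))_{⟨Lz, Lz+Le_κ⟩}` — the linear counterpart of `B7Eq92Concrete.dbavgCovIter_succ`.
[cite: Balaban1985BackgroundPropagators, (3.15) p.393; Balaban1985Averaging, (91) p.31] -/
theorem QjOp_succ_apply (j : ℕ) (A : Site d → Fin d → 𝔸) (z : Site d) (κ : Fin d) :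
    QjOp hL hα1 hU1 hreg (j + 1) A z κ = linQcov L (avgIter L U j) (QjOp hL hα1 hU1 hreg j A) ((L : ℤ) • z) κ := rfl

/-- `(L·Q_1(U)A)(z, κ) = L(Q(U)A)_{⟨Lz, Lz+Le_κ⟩}` — the first factor is (`L` times) the one-step operator at the background `U` itself (`Ū^0 = U`).
[cite: Balaban1985BackgroundPropagators, (3.15) p.393] -/
theorem QjOp_one_apply (A : Site d → Fin d → 𝔸) (z : Site d) (κ : Fin d) :
    QjOp hL hα1 hU1 hreg 1 A z κ = linQcov L U A ((L : ℤ) • z) κ := rfl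

end Composite

end Literature.MathematicalPhysics.QuantumFieldTheory.Balaban1983to89.B7Eq122LinearPartIsLinear

end
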